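import Literature.MathematicalPhysics.QuantumFieldTheory.MullerSchiemann1987.MS87Theorem3Extensions
import Literature.MathematicalPhysics.QuantumFieldTheory.MullerSchiemann1987.MS87ClassFunctionsSU2
import HarnessLib

/-!
# Müller–Schiemann, *Continuum limit of a hierarchical SU(2) lattice gauge theory in 4 dimensions*
# (CMP 110, 1987), THEOREM 3 on `SU(2)` FROM THE REAL SLICE: the structural hypotheses of the siblings — evenness
# (2.12), `2π`-periodicity (2.11) of `h_N^{(−n)}`, and `g_N^{(−n)} = h_N^{(−n)} ∘ arccos ∘ u₀` (2.16) — DERIVED from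
# the class-function property (2.2) and the real slice `h(x) = g(e^{−ixσ₃})` ((2.6), (2.10)) by the identity theorem
# (theorems only; no definition, no named fact)

statement-level skeleton of published theorems with citation tags; proofs where landed; nothing here is a claim about the Yang–Mills mass gap

**Citation header (reproduction of PUBLISHED work).** V. F. Müller, J. Schiemann, *Continuum limit of a hierarchical
SU(2) lattice gauge theory in 4 dimensions*, Commun. Math. Phys. **110** (1987) 261–286, doi 10.1007/BF01207367
[MullerSchiemann1987]; Theorem 3 p.282 and its proof pp.282–283; (2.2) p.263; (2.6), (2.10)–(2.12) p.264; (2.16) p.265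
(held Project Euclid scan `paper:url-96df5da18d4c`; displays read by this seat on its own 3× page renders
`run/shared/lean/pub/lit-balaban/lit-balaban-p12/renders-cmp110ms/ms87-cmp110-pdfp003,004,005,022,023-journalp263,264,
265,282,283-x3.png`). Lean lane of the lit-balaban YM LIT SWEEP CONTEXT row X1 (register level; zero weight for any
token of that table); the model is the `d = 4` HIERARCHICAL `SU(2)` gauge model, NOT lattice Yang–Mills.

**What the paper prints.** (2.6) p.264: *«g̃⁽ⁿ⁾(u, x) = g⁽ⁿ⁾(e^{−ixσ₃}u)»*; (2.10)–(2.12) p.264: *«h⁽ⁿ⁾(z) := g̃⁽ⁿ⁾(e₀, z).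
(2.10) Obviously, h⁽ⁿ⁾(z + 2π) = h⁽ⁿ⁾(z), (2.11) h⁽ⁿ⁾(−z) = h⁽ⁿ⁾(z). (2.12)»*; (2.16) p.265: *«g̃⁽ⁿ⁾(u, x) =
g⁽ⁿ⁾(e^{−ixσ₃}u) = g⁽ⁿ⁾(e^{−iθσ₃}) = h⁽ⁿ⁾(θ)»*; Theorem 3 p.282 (quoted in full in the sibling
`MS87Theorem3CommonSubsequence`).

**What this file proves (kernel-checked, 0 sorry, standard axioms; no definition, no named fact).**
* §1 **(2.12) and (2.11) ON THE STRIP from the real slice**: if `h` is holomorphic on `{|Im z| < d}` and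
  `h(x) = g(e^{−ixσ₃})` for real `x` with `g` a class function on `SU(2)`, then `h(−z) = h(z)` and `h(z + 2π) = h(z)` on
  the strip (`even_on_strip`, `periodic_on_strip`: the sibling `ClassFunctionsSU2`'s `angular_even` /
  `angular_periodic` on the reals, then the tree's identity theorem `eqOn_setOf_abs_im_lt_of_forall_ofReal`).
* §2 **THEOREM 3 on `SU(2)` (`r = 2`) FROM THE REAL SLICE** (`theorem3_SU2_real_slice`): input ONLY (a) `h_N^{(−n)}`
  holomorphic on `{|Im z| < d_n}` and bounded there by `M_n` ((A₁)/Theorem 2 part 1) and (6.18)), (b) the real slice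
  `h_N^{(−n)}(x) = g_N^{(−n)}(e^{−ixσ₃})` ((2.6)/(2.10)), (c) `g_N^{(−n)} ∈ 𝒢` ((2.1)–(2.2)), (d) the recursion
  `𝒯₂ g_N^{(−n−1)} = g_N^{(−n)}`, (e) strips with `d_n ≤ 2d_{n+1}`, `2^m d_{n+m} → ∞`; output = the conclusions of the
  sibling `Theorem3Extensions.theorem3_SU2_entire`: one strictly increasing `N_j`; at every scale `h^{(−n)}`
  holomorphic with (6.19) locally uniformly on the strip, `g^{(−n)} ∈ 𝒢` with (6.22) uniformly and
  `𝒯₂ g^{(−n−1)} = g^{(−n)}`, `H^{(−n)}` holomorphic on the ellipse with (6.20) and `g^{(−n)} = H^{(−n)}(u₀)`, and the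
  extensions `g̃^{(−n)}(u, ·)` restrictions of ENTIRE functions. Mechanism: the strip representatives
  `h·𝟙_{|Im z|<d_n}` are globally even / `2π`-periodic by §1, and `g = h ∘ arccos ∘ u₀` on them is the sibling's
  `eq216_arccos`; the conclusions transfer back to `h` on the strip (`TendstoLocallyUniformlyOn.congr`).

**Readings / scope (declared).** As in the siblings: the common subsequence is obtained by the Cantor diagonal and
property (i) (property (ii) neither used nor claimed; see `MS87Theorem3Climb` for the printed climb with (ii) as
hypothesis); `r = 2` written out; the growth conditions on `d_n` render «the wider strip» / «r^m(β^{(−n−m)})^{−α} → ∞».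

**Not claimed.** Theorems 1, 2, 4; property (ii); anything about lattice Yang–Mills or the Clay problem.
-/

noncomputable section

open Filter Set Metric Function Complex
open scoped Topology Real

namespace Literature.MathematicalPhysics.QuantumFieldTheory

namespace MullerSchiemann1987

namespace Theorem3FromRealSlice

open Literature.Analysis.Complex (isOpen_setOf_abs_im_lt eqOn_setOf_abs_im_lt_of_forall_ofReal)
open HeatKernel (u0 u3 diagPhase)
open Migdal (InG migdal)
open ClassFunctionsSU2 (angular_even angular_periodic eq216_arccos)
open Theorem3Extensions (theorem3_SU2_entire)

/-! ## §1 (2.11)–(2.12) on the strip from the real slice (2.6)/(2.10): evenness and `2π`-periodicity of `h_N^{(−n)}`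
follow from the class-function property (2.2) by the identity theorem -/

/-- **(2.12) on the strip**: if `h` is holomorphic on `{|Im z| < d}` (`d > 0`) and `h(x) = g(e^{−ixσ₃})` for real `x`
with `g` a class function on `SU(2)`, then `h(−z) = h(z)` on the strip. [cite: MullerSchiemann1987, (2.12) p.264,
(2.6) p.264, (2.16) p.265] -/
theorem even_on_strip {d : ℝ} (hd : 0 < d) {h : ℂ → ℂ} {g : Matrix.specialUnitaryGroup (Fin 2) ℂ → ℝ}
    (hh : DifferentiableOn ℂ h {z : ℂ | |z.im| < d}) (hg : ∀ u v, g (v * u * v⁻¹) = g u)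
    (hreal : ∀ x : ℝ, h x = (g (diagPhase x) : ℂ)) {z : ℂ} (hz : |z.im| < d) : h (-z) = h z := by
  have hneg : DifferentiableOn ℂ (fun w : ℂ => h (-w)) {z : ℂ | |z.im| < d} := by
    refine hh.comp differentiable_neg.differentiableOn fun w (hw : |w.im| < d) => ?_
    show |(-w).im| < d
    simpa using hw
  have key := eqOn_setOf_abs_im_lt_of_forall_ofReal hd hneg hh fun t => by
    show h (-(t : ℂ)) = h t
    rw [show (-(t : ℂ)) = ((-t : ℝ) : ℂ) by push_cast; ring, hreal, hreal, angular_even hg]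
  exact key hz

/-- **(2.11) on the strip**: under the same hypotheses `h(z + 2π) = h(z)` on the strip. [cite: MullerSchiemann1987,
(2.11) p.264, (2.6) p.264, (2.16) p.265] -/
theorem periodic_on_strip {d : ℝ} (hd : 0 < d) {h : ℂ → ℂ} {g : Matrix.specialUnitaryGroup (Fin 2) ℂ → ℝ}
    (hh : DifferentiableOn ℂ h {z : ℂ | |z.im| < d}) (hg : ∀ u v, g (v * u * v⁻¹) = g u)
    (hreal : ∀ x : ℝ, h x = (g (diagPhase x) : ℂ)) {z : ℂ} (hz : |z.im| < d) : h (z + 2 * π) = h z := by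
  have hsh : DifferentiableOn ℂ (fun w : ℂ => h (w + 2 * π)) {z : ℂ | |z.im| < d} := by
    refine hh.comp ((differentiable_id.add_const _).differentiableOn) fun w (hw : |w.im| < d) => ?_
    show |(w + 2 * π).im| < d
    simpa using hw
  have key := eqOn_setOf_abs_im_lt_of_forall_ofReal hd hsh hh fun t => by
    show h ((t : ℂ) + 2 * π) = h t
    rw [show ((t : ℂ) + 2 * π) = ((t + 2 * Real.pi : ℝ) : ℂ) by push_cast; ring, hreal, hreal,
      angular_periodic hg]
  exact key hz

/-! ## §2 The strip representatives `h♯ = h·𝟙_{|Im z|<d}` (globally even/periodic) and THEOREM 3 on `SU(2)` with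
the structural hypotheses of the siblings DERIVED: input = holomorphy and the bound (6.18) on the strips, the real
slice (2.6)/(2.10) `h_N^{(−n)}(x) = g_N^{(−n)}(e^{−ixσ₃})`, `g_N^{(−n)} ∈ 𝒢`, the recursion `𝒯₂ g_N^{(−n−1)} = g_N^{(−n)}` -/

/-- **THEOREM 3 on `SU(2)` (`r = 2`) from the real slice.** Cutoff families: `h_N^{(−n)}` holomorphic on
`{|Im z| < d_n}` and bounded there by `M_n` ((A₁), (6.18)), with real slice `h_N^{(−n)}(x) = g_N^{(−n)}(e^{−ixσ₃})`
((2.6)/(2.10)), `g_N^{(−n)} ∈ 𝒢` ((2.1)–(2.2)), `𝒯₂ g_N^{(−n−1)} = g_N^{(−n)}`; strips with `d_n ≤ 2d_{n+1}`,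
`2^m d_{n+m} → ∞`. Then (evenness, periodicity and `g = h ∘ arccos ∘ u₀` being DERIVED from (2.2) — siblings
`ClassFunctionsSU2`, §1): ONE strictly increasing `N_j` and, at every scale, limits `h^{(−n)}` (holomorphic; (6.19)
locally uniformly ON THE STRIP), `g^{(−n)} ∈ 𝒢` ((6.22) uniformly; `𝒯₂ g^{(−n−1)} = g^{(−n)}`), `H^{(−n)}` holomorphic on
the ellipse with (6.20) on the strip and `g^{(−n)} = H^{(−n)}(u₀)`, and the extensions
`g̃^{(−n)}(u, ·) = H^{(−n)}(u₀ cos · + u₃ sin ·)` restrictions of ENTIRE functions ((A₁)).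
[cite: MullerSchiemann1987, Thm 3 p.282, proof pp.282–283, (2.2) p.263, (2.6), (2.10)–(2.12) p.264, (2.16) p.265] -/
theorem theorem3_SU2_real_slice {d M : ℕ → ℝ} (hd : ∀ n, 0 < d n) (hd2 : ∀ n, d n ≤ 2 * d (n + 1))
    (hdiv : ∀ n, Tendsto (fun m : ℕ => (2 : ℝ) ^ m * d (n + m)) atTop atTop)
    {h : ℕ → ℕ → ℂ → ℂ} {g : ℕ → ℕ → Matrix.specialUnitaryGroup (Fin 2) ℂ → ℝ}
    (hhol : ∀ N n, n ≤ N → DifferentiableOn ℂ (h N n) {z : ℂ | |z.im| < d n})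
    (hbd : ∀ N n, n ≤ N → ∀ z : ℂ, |z.im| < d n → ‖h N n z‖ ≤ M n)
    (hreal : ∀ N n, n ≤ N → ∀ x : ℝ, h N n x = (g N n (diagPhase x) : ℂ))
    (hG : ∀ N n, n ≤ N → InG (g N n))
    (hrec : ∀ N n, n + 1 ≤ N → migdal 2 (g N (n + 1)) = g N n) :
    ∃ Nj : ℕ → ℕ, StrictMono Nj ∧ ∃ hlim : ℕ → ℂ → ℂ, ∃ glim : ℕ → Matrix.specialUnitaryGroup (Fin 2) ℂ → ℝ,
      ∃ Hlim : ℕ → ℂ → ℂ,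
      (∀ n, DifferentiableOn ℂ (hlim n) {z : ℂ | |z.im| < d n} ∧
        TendstoLocallyUniformlyOn (fun j => h (Nj j) n) (hlim n) atTop {z : ℂ | |z.im| < d n} ∧
        TendstoUniformly (fun j => g (Nj j) n) (glim n) atTop ∧
        InG (glim n) ∧ migdal 2 (glim (n + 1)) = glim n ∧
        DifferentiableOn ℂ (Hlim n)
          {w : ℂ | w.re ^ 2 / Real.cosh (d n) ^ 2 + w.im ^ 2 / Real.sinh (d n) ^ 2 < 1} ∧
        (∀ z : ℂ, |z.im| < d n → hlim n z = Hlim n (Complex.cos z)) ∧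
        (∀ U, ((glim n U : ℝ) : ℂ) = Hlim n (u0 U))) ∧
      ∀ n (U : Matrix.specialUnitaryGroup (Fin 2) ℂ), ∃ F : ℂ → ℂ, Differentiable ℂ F ∧
        EqOn F (fun z : ℂ => Hlim n ((u0 U : ℂ) * Complex.cos z + (u3 U : ℂ) * Complex.sin z))
          {z : ℂ | |z.im| < d n} := by
  -- the strip representatives
  set hs : ℕ → ℕ → ℂ → ℂ := fun N n z => if |z.im| < d n then h N n z else 0 with hs_def
  have hs_of_mem : ∀ N n {z : ℂ}, |z.im| < d n → hs N n z = h N n z := fun N n z hz => by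
    simp [hs_def, hz]
  have hs_eqOn : ∀ N n, EqOn (hs N n) (h N n) {z : ℂ | |z.im| < d n} := fun N n z hz => hs_of_mem N n hz
  have hhol' : ∀ N n, n ≤ N → DifferentiableOn ℂ (hs N n) {z : ℂ | |z.im| < d n} :=
    fun N n hN => (hhol N n hN).congr (hs_eqOn N n)
  have hbd' : ∀ N n, n ≤ N → ∀ z : ℂ, |z.im| < d n → ‖hs N n z‖ ≤ M n := fun N n hN z hz => by
    rw [hs_of_mem N n hz]; exact hbd N n hN z hz
  have hper' : ∀ N n, n ≤ N → Function.Periodic (hs N n) (2 * π) := by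
    intro N n hN z
    by_cases hz : |z.im| < d n
    · have hz' : |(z + 2 * π).im| < d n := by simpa using hz
      rw [hs_of_mem N n hz', hs_of_mem N n hz]
      exact periodic_on_strip (hd n) (hhol N n hN) (hG N n hN).central (hreal N n hN) hz
    · simp [hs_def, hz]
  have heven' : ∀ N n, n ≤ N → ∀ z, hs N n (-z) = hs N n z := by
    intro N n hN z
    by_cases hz : |z.im| < d n
    · have hz' : |(-z).im| < d n := by simpa using hz
      rw [hs_of_mem N n hz', hs_of_mem N n hz]
      exact even_on_strip (hd n) (hhol N n hN) (hG N n hN).central (hreal N n hN) hz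
    · simp [hs_def, hz]
  have hgh' : ∀ N n, n ≤ N → ∀ U : Matrix.specialUnitaryGroup (Fin 2) ℂ,
      (g N n U : ℂ) = hs N n (Real.arccos (u0 U)) := by
    intro N n hN U
    have hz : |((Real.arccos (u0 U) : ℝ) : ℂ).im| < d n := by
      rw [Complex.ofReal_im, abs_zero]; exact hd n
    rw [hs_of_mem N n hz, hreal N n hN, eq216_arccos (hG N n hN).central U]
  obtain ⟨Nj, hNj, hlim, glim, Hlim, hall, hent⟩ :=
    theorem3_SU2_entire hd hd2 hdiv hhol' hbd' hper' heven' hgh' hG hrec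
  refine ⟨Nj, hNj, hlim, glim, Hlim, fun n => ⟨(hall n).1, ?_, (hall n).2.2⟩, hent⟩
  exact (hall n).2.1.congr fun j => hs_eqOn (Nj j) n

end Theorem3FromRealSlice

end MullerSchiemann1987

end Literature.MathematicalPhysics.QuantumFieldTheory
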